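import Literature.AlgebraicGeometry.Motives.AbelianVarietyStructureDescent
import HarnessLib

/-!
# `stub_descendStructure` of line `a2-casselman-descent` (binder `h21` → `Hyp21`, Shimura 1998 Thm. 21.4)

Cell `hodgecm-mathlib` (D-0151 release track, ladder HODGECM-MATHLIB rung 0), fan A, rung A-II,
KEY `a2-descend-structure`.  The line `a2-casselman-descent` (crux workfile
`A-plan/lines/a2-casselman-descent.lean`, v1 3c7863777766dae9 = v2 f4883be66fcd872b = v3 for this stub, namespace
`Summit.HodgeConjecture.CorCM.Cruxes.Hyp21.CasselmanDescent`) splits Shimura's proof of Thm. 21.4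
(Casselman; [Shimura1998] p. 192) into a structure over a number field, a twisted Galois model, and
**Weil descent of the structure `(A₂, ι₂, ρ)`** — the registered DERIVATION stub
`stub_descendStructure`: an abelian variety over a finite Galois `k₂ / k` with a semilinear
`Gal(k₂/k)`-action compatible with its group law and an `𝓞_K`-action commuting with it descends,
together with the `𝓞_K`-action, to `k` (Shimura Prop. 21.1 for the constant family).

This file closes that stub with its EXACT registered signature, by the Literature theorem
`Literature.AlgebraicGeometry.Motives.AbelianVariety.exists_descent_with_end`
(`Literature/AlgebraicGeometry/Motives/AbelianVarietyStructureDescent`), itself assembled from the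
tree's PROVED Weil descent of abelian varieties (`GaloisDescentAbelianVariety.exists_iso_baseChange`,
Milne *Jacobian Varieties* 1.9) and Galois descent of homomorphisms of abelian varieties
(`AbelianVariety.galoisDescent`, Görtz–Wedhorn I Thm. 14.72 (1)).  No named fact is used; the
statement is unconditional.  HC_CM itself is proved only modulo the 7 printed citations until
rung 0 closes — this file discharges one derivation stub of the `h21` line, nothing more.
-/

set_option autoImplicit false

noncomputable section

open CategoryTheory
open scoped NumberField
open MonoidalCategory CartesianMonoidalCategory
open scoped MonObj

namespace Summit.HodgeConjecture.CorCM.Cruxes.Hyp21.CasselmanDescent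

open Literature.AlgebraicGeometry.Motives

/-- **`stub_descendStructure` holds (Weil descent of the structure `(A₂, ι₂, ρ)`; Shimura 1998,
§21.1 Prop. 21.1 as used on p. 192).**  For `k₂ / k` finite Galois, an abelian variety `A₂ / k₂`
with a semilinear `Gal(k₂/k)`-action `ρ` on the `k`-scheme `A₂` (`ρ σ` over `Spec σ⁻¹`) compatible
with multiplication, unit and inversion, and `ι₂ : 𝓞_K → End A₂` commuting with every `ρ σ`, there
are `A₀ / k`, `e : A₂ ≅ A₀ ⊗_k k₂` carrying `ρ σ` to `1 × Spec σ⁻¹` (`AbelianVariety.gal`), and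
`ι₀ : 𝓞_K → End A₀` with `ι₂(a) ≫ e = e ≫ ι₀(a)_{k₂}`.  The statement is the registered stub's,
verbatim; the proof is the Literature theorem `AbelianVariety.exists_descent_with_end`.
[cite: Shimura1998, §21.1 Prop. 21.1 (pp. 188–189) and §21.4 (p. 192)] -/
theorem stub_descendStructure_holds :
    ∀ (k k₂ : Type) [Field k] [Field k₂] [Algebra k k₂] [FiniteDimensional k k₂] [IsGalois k k₂]
      (K : Type) [Field K] (A₂ : AbelianVariety k₂) (ι₂ : 𝓞 K →+* End A₂)
      (ρ : Literature.AlgebraicGeometry.RelativeSpec.ActionOver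
        (A₂.X.hom ≫ AbelianVariety.bcSpec k k₂) (k₂ ≃ₐ[k] k₂))
      (hρ : ∀ σ, (ρ.aut σ).hom ≫ A₂.X.hom = A₂.X.hom ≫ AbelianVariety.specAut k₂ σ⁻¹),
    (∀ σ, GaloisDescentAbelianVariety.aut₂ k₂ A₂ ρ hρ σ ≫ μ[A₂.X].left = μ[A₂.X].left ≫ (ρ.aut σ).hom) →
    (∀ σ, η[A₂.X].left ≫ (ρ.aut σ).hom = AbelianVariety.specAut k₂ σ⁻¹ ≫ η[A₂.X].left) →
    (∀ σ, ι[A₂.X].left ≫ (ρ.aut σ).hom = (ρ.aut σ).hom ≫ ι[A₂.X].left) →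
    (∀ σ (a : 𝓞 K), (ρ.aut σ).hom ≫ AbelianVariety.Hom.toSchemeHom (ι₂ a : A₂ ⟶ A₂) =
        AbelianVariety.Hom.toSchemeHom (ι₂ a : A₂ ⟶ A₂) ≫ (ρ.aut σ).hom) →
    ∃ (A₀ : AbelianVariety k) (e : A₂ ≅ A₀.baseChange k₂) (ι₀ : 𝓞 K →+* End A₀),
      (∀ σ, (ρ.aut σ).hom ≫ AbelianVariety.Hom.toSchemeHom e.hom =
          AbelianVariety.Hom.toSchemeHom e.hom ≫ A₀.gal k₂ σ) ∧
      (∀ a : 𝓞 K, (ι₂ a : A₂ ⟶ A₂) ≫ e.hom = e.hom ≫ AbelianVariety.Hom.baseChange k₂ (ι₀ a : A₀ ⟶ A₀)) :=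
  fun _k k₂ _ _ _ _ _ K _ A₂ ι₂ ρ hρ hmul hone hinv hι ↦
    AbelianVariety.exists_descent_with_end k₂ A₂ ρ hρ hmul hone hinv K ι₂ hι

end Summit.HodgeConjecture.CorCM.Cruxes.Hyp21.CasselmanDescent

end
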